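import Mathlib
import HarnessLib

/-!
# Palm-mismatch collision operator, I: the hard-tether harmonic ring (matrix objects)

Topic `Literature/MathematicalPhysics/KineticTheory`; definition request `defn-palmMismatchOperator`
(route CollisionNoise; cruxes PalmBoltzmannLimit `stmt-AtomisticToContinuum-7296`, KineticUpperBound
`stmt-AtomisticToContinuum-6563`), finite-ring part: "the finite-ring (`n` sites) matrix version for
certified numerics" together with the Palm/Slepian data from which the operator is DERIVED. The
`k`-space operator is `PhononBoltzmann.palmMismatchOperator` (`PalmMismatchOperator.lean`); the
theorems about the objects defined here are in `PalmMismatchRingTheorems.lean`.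

## Setting

The pinned harmonic ring `ℤ/n`: sites `x : ZMod n`, phase space `ℝ^{ZMod n} ⊕ ℝ^{ZMod n}`
(`PhaseIdx n`, positions `inl`, momenta `inr`), force matrix `Φ = ω₂ + Σ_x ∇_x∇_xᵀ` (`forceMatrix`,
`∇_x = e_{x+1} - e_x` = `siteGrad x`), free flow `σ̇ = Aσ`, `A = [[0,1],[-Φ,0]]` (`flowMatrix`), Gibbs
covariance `G_T = T diag(Φ⁻¹, 1)` (`gibbsCov`). Bond `x` carries the stretch covector
`ℓ_r = (∇_x, 0)` (`stretchCovector`) and its velocity `ℓ_ṙ = ℓ_r A = (0, ∇_x)` (`velCovector`); the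
hard tether `|r_x| ≤ 1` acts at a hit by the momentum exchange `R_x = 1 - ℓ_ṙ*ℓ_ṙ` (`exchangeMatrix`,
`p_x ↔ p_{x+1}`; the request's `1 + d_x ℓ_ṙ` with `d_x = -ℓ_ṙ*`).

## The Palm data and the request's recipe (Aldous 1989, §C12, §C22–C25)

For a stationary Gaussian law with flow-invariant covariance `C` (`IsFlowInvariant A C`, so
`Cov(r_x, ṙ_x) = 0`): `λ₀ = ℓ_r C ℓ_r*` (`stretchVar`), `λ₂ = ℓ_ṙ C ℓ_ṙ*` (`velVar`), the regression
patterns `u = Cℓ_r*/λ₀` (`palmBump`), `w = Cℓ_ṙ*/λ₂` (`palmDrift`) [Aldous1989, (C22a)]; at an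
up-crossing of the level `b = 1` by `r_x` the Palm law of the configuration is `σ = u + wV + κ`, `V`
Rayleigh of parameter `λ₂` (`E V = √(πλ₂/2)` = `rayleighMean λ₂`, `E V² = 2λ₂`) independent of the
residual field `κ` [Aldous1989, Lemma C12.1 (C12g), (C22c), (C25c)], at a down-crossing `σ = u - wV + κ`;
hence the Palm second moments `M^± = C + (1-λ₀)uuᵀ + λ₂wwᵀ ± √(πλ₂/2)(uwᵀ + wuᵀ)`
(`palmSecondMoment (±1)`), and the up-crossing rate is Rice's `ν⁺ = (2π)⁻¹√(λ₂/λ₀)e^{-1/(2λ₀)}`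
(`riceRate`) [Aldous1989, (C12f), (C23b)]. The free flow carries each up-crossing to the next
down-crossing, a flow-covariant bijection between two stationary point processes of equal
intensity, so it transports the up-crossing Palm law to the down-crossing one [HevelingLast2005,
Thm 1.1]; the request's "E_Palm[(state after `R_x`)^{⊗2} - (state after the free turnaround)^{⊗2}]" is
therefore `Δ_x(C) = R_x M⁺ R_xᵀ - M⁻` (`palmMismatchIncrement`), and summing over bonds and both walls
`r = ±1` (equal second moments) with the Rice weights, per unit of the Gibbs two-sided rate, gives
the nonlinear field `𝒩_T` (`palmCollisionField`). The request's `𝒦` is the derivative of `𝒩_T` at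
`G_T` (in flow-invariant directions), flow-averaged.

## The linearisation (closed form; proofs in `PalmMismatchRingTheorems.lean`)

`Δ_x(C) = λ₂(m dᵀ + d mᵀ) + √(πλ₂/2)(u mᵀ + m uᵀ)` with `m = 2w + d`, `d = -ℓ_ṙ*`; under `G_T`,
`w = ℓ_ṙ*/2` so `m = 0` and `Δ_x(G_T) = 0` EXACTLY (`palmMismatchIncrement_gibbsCov`) — collisions are
invisible at equilibrium and the derivative of the Rice weight multiplies zero. Differentiating,
`DΔ_x(G_T)[δC] = 2(R_xδCR_xᵀ - δC) + √(πT)(u_x m'ᵀ + m' u_xᵀ)`, `m' = T⁻¹(δCℓ_ṙ* - ℓ_ṙ*(ℓ_ṙδCℓ_ṙ*)/2)`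
(`exchangeIncrement`, `palmKick`, `palmTilt`), whence `palmMismatchLin = Σ_x DΔ_x(G_T)` — the matrix
of the request's operator BEFORE the flow average (checked against central differences of `𝒩_T` on
rings `n = 3, 5`, agreement `10⁻¹⁰`, unit notes). MAIN THEOREM (`trace_mul_palmMismatchLin`): for every
flow-invariant symmetric `δC` and every flow-invariant symmetric form `Q`,
`tr(Q · palmMismatchLin δC) = 2 tr(Q · Σ_x (R_xδCR_xᵀ - δC))` — all flow-invariant matrix elements of
the Palm tilt vanish on the ring, so the flow-averaged operator is TWICE the flow-averaged generator
of the nearest-neighbour exchange noise of [BasileBernardinJaraKomorowskiOlla2016, §1] per unit rate,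
independently of `T`; its `k`-space form is `PhononBoltzmann.palmMismatchOperator`.

## Design notes

* The flow average `Π` is not introduced as an operator: `Π M` is determined by the pairings
  `tr(QM)` with flow-invariant forms `Q` (`tr(Q ΠM) = tr(QM)`), and every statement is made in that
  paired form ("the quadratic form in the `G_T` inner product": `⟨δC', ·⟩_{G_T} = ½tr(G⁻¹δC'G⁻¹ ·)`
  and `Q = G⁻¹δC'G⁻¹` is a flow-invariant form when `δC'` is a flow-invariant covariance).
* `IsFlowInvariant`/`IsFlowInvariantForm` are stated for a general generator `A` (Mathlib generality).
* The ring (not the open chain) because the request's setting is homogeneous (`λ₀,x = λ₀`,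
  `stretchVar_gibbsCov_eq`); `n = 1, 2` are allowed (degenerate but consistent); lemmas needing two
  distinct bond ends assume `Fact (1 < n)`.
* Junk values: `Φ⁻¹ = 0` for singular `Φ` (excluded by `ω₂ > 0`, `forceMatrix_posDef`), `x⁻¹ = 0`
  scalars in `palmBump/palmDrift/palmKick/palmCollisionField` at degenerate data.
* Not here: the Gaussian/Slepian MODEL of pre-collision laws is the request's prescription, not a
  theorem about the tethered dynamics; no point-process theory is formalised (the cited Palm facts
  only motivate the definitions `palmSecondMoment`, `riceRate`, `palmMismatchIncrement`).
-/

noncomputable section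

open Matrix Finset

namespace Literature.MathematicalPhysics.KineticTheory.PalmMismatch

/-! ### §1. The `n`-ring: force matrix, flow, Gibbs covariance, bond covectors, exchange -/

variable {n : ℕ} [NeZero n]

/-- Phase-space index of the `n`-ring `ℤ/n`: positions `Sum.inl x`, momenta `Sum.inr x`. [folklore] -/
abbrev PhaseIdx (n : ℕ) := ZMod n ⊕ ZMod n

/-- The discrete gradient pattern of bond `(x, x+1)`: `∇_x = e_{x+1} - e_x` on sites, so that
`∇_x · q = q_{x+1} - q_x` is the stretch of the bond. [folklore] -/
def siteGrad (x : ZMod n) : ZMod n → ℝ :=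
  Pi.single (x + 1) 1 - Pi.single x 1

/-- The stretch covector `ℓ_r` of bond `x` on phase space: `ℓ_r · σ = q_{x+1} - q_x`. [folklore] -/
def stretchCovector (x : ZMod n) : PhaseIdx n → ℝ :=
  Sum.elim (siteGrad x) 0

/-- The stretch-velocity covector `ℓ_ṙ = ℓ_r A` of bond `x`: `ℓ_ṙ · σ = p_{x+1} - p_x`; as a
vector it is `-d_x`, `d_x = e_{p_x} - e_{p_{x+1}}` the exchange direction of the request. [folklore] -/
def velCovector (x : ZMod n) : PhaseIdx n → ℝ :=
  Sum.elim 0 (siteGrad x)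

variable (n) in
/-- The bond Laplacian `-Δ = Σ_x ∇_x ∇_xᵀ` of the ring (sum over the `n` bonds; for `n = 2` the two
bonds coincide and are both counted, for `n = 1` it is `0`). [folklore] -/
def bondLaplacian : Matrix (ZMod n) (ZMod n) ℝ :=
  ∑ x : ZMod n, vecMulVec (siteGrad x) (siteGrad x)

variable (n) in
/-- The force matrix `Φ = ω₂ - Δ` of the pinned harmonic ring (Hessian of
`Σ_x ω₂ q_x²/2 + (q_{x+1} - q_x)²/2`). [cite: BasileBernardinJaraKomorowskiOlla2016, §1 (Hamiltonian
`ℋ = Σ p_x²/2 + ½ Σ α_{x-x'} q_x q_{x'}`, pinned case `α̂(0) > 0`)] -/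
def forceMatrix (ω₂ : ℝ) : Matrix (ZMod n) (ZMod n) ℝ :=
  ω₂ • (1 : Matrix (ZMod n) (ZMod n) ℝ) + bondLaplacian n

variable (n) in
/-- The generator `A = [[0, 1], [-Φ, 0]]` of the free harmonic flow `q̇ = p`, `ṗ = -Φq` on the ring.
[folklore] -/
def flowMatrix (ω₂ : ℝ) : Matrix (PhaseIdx n) (PhaseIdx n) ℝ :=
  Matrix.fromBlocks 0 1 (-forceMatrix n ω₂) 0

variable (n) in
/-- The Gibbs covariance `G_T = T · diag(Φ⁻¹, 1)` of the pinned harmonic ring at temperature `T`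
(junk `Φ⁻¹ = 0` if `Φ` is singular, i.e. never for `ω₂ > 0`). [folklore] -/
def gibbsCov (ω₂ T : ℝ) : Matrix (PhaseIdx n) (PhaseIdx n) ℝ :=
  Matrix.fromBlocks (T • (forceMatrix n ω₂)⁻¹) 0 0 (T • (1 : Matrix (ZMod n) (ZMod n) ℝ))

/-- The momentum exchange `R_x = 1 + d_x ℓ_ṙ = 1 - ℓ_ṙ* ℓ_ṙ` of bond `x` (elastic equal-mass
collision `p_x ↔ p_{x+1}`, positions untouched; see `exchangeMatrix_mulVec_inr`).
[cite: BasileBernardinJaraKomorowskiOlla2016, §1 (the configuration `p^{x,x+1}`)] -/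
def exchangeMatrix (x : ZMod n) : Matrix (PhaseIdx n) (PhaseIdx n) ℝ :=
  1 - vecMulVec (velCovector x) (velCovector x)

/-- A (covariance) matrix `C` is invariant under the linear flow `e^{tA}`: `AC + CAᵀ = 0`
(`d/dt e^{tA} C e^{tAᵀ} = 0`). [folklore] -/
def IsFlowInvariant {ι : Type*} [Fintype ι] (A C : Matrix ι ι ℝ) : Prop :=
  A * C + C * Aᵀ = 0

/-- A quadratic form (observable) `σ ↦ σᵀQσ` is invariant under the flow `e^{tA}`: `QA + AᵀQ = 0`.
[folklore] -/
def IsFlowInvariantForm {ι : Type*} [Fintype ι] (A Q : Matrix ι ι ℝ) : Prop :=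
  Q * A + Aᵀ * Q = 0

/-! ### §2. Palm / Slepian data of a Gaussian law at a tether hit of bond `x` (level `b = 1`) -/

/-- `λ₀ = Var(r_x) = ℓ_r C ℓ_r*`. [cite: Aldous1989, §C22] -/
def stretchVar (C : Matrix (PhaseIdx n) (PhaseIdx n) ℝ) (x : ZMod n) : ℝ :=
  stretchCovector x ⬝ᵥ C *ᵥ stretchCovector x

/-- `λ₂ = Var(ṙ_x) = ℓ_ṙ C ℓ_ṙ*` (Aldous's `θ` for the normalised process).
[cite: Aldous1989, §C22 (C22c)] -/
def velVar (C : Matrix (PhaseIdx n) (PhaseIdx n) ℝ) (x : ZMod n) : ℝ :=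
  velCovector x ⬝ᵥ C *ᵥ velCovector x

/-- The Palm position bump `u = C ℓ_r* / λ₀`: `E[σ | r_x = b, ṙ_x = v] = b u + v w` (Gaussian
regression, `Cov(r, ṙ) = 0`). [cite: Aldous1989, §C22 (C22a)] -/
def palmBump (C : Matrix (PhaseIdx n) (PhaseIdx n) ℝ) (x : ZMod n) : PhaseIdx n → ℝ :=
  (stretchVar C x)⁻¹ • C *ᵥ stretchCovector x

/-- The Palm velocity pattern `w = C ℓ_ṙ* / λ₂` (under `G_T`: `w = ℓ_ṙ*/2 = -d_x/2`,
`palmDrift_gibbsCov`). [cite: Aldous1989, §C22 (C22a)] -/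
def palmDrift (C : Matrix (PhaseIdx n) (PhaseIdx n) ℝ) (x : ZMod n) : PhaseIdx n → ℝ :=
  (velVar C x)⁻¹ • C *ᵥ velCovector x

/-- The mean `E V = √(πλ₂/2)` of the Rayleigh law of parameter `λ₂` (density `v e^{-v²/2λ₂}/λ₂`),
the Palm law of the crossing speed. [cite: Aldous1989, §C25 (C25c)] -/
def rayleighMean (lam : ℝ) : ℝ :=
  Real.sqrt (Real.pi * lam / 2)

/-- The Palm second-moment matrix at a crossing of `r_x = 1` with sign `s` (`s = 1`: up-crossing,
`s = -1`: down-crossing): with `σ = u + s w V + κ`, `V` Rayleigh(`λ₂`) (`E V² = 2λ₂`) independent of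
`κ ∼ N(0, C - λ₀uuᵀ - λ₂wwᵀ)`,
`M^s = C + (1 - λ₀) uuᵀ + λ₂ wwᵀ + s √(πλ₂/2) (uwᵀ + wuᵀ)`.
[cite: Aldous1989, §C12 Lemma C12.1 and §C25 (C25c)] -/
def palmSecondMoment (s : ℝ) (C : Matrix (PhaseIdx n) (PhaseIdx n) ℝ) (x : ZMod n) :
    Matrix (PhaseIdx n) (PhaseIdx n) ℝ :=
  C + (1 - stretchVar C x) • vecMulVec (palmBump C x) (palmBump C x)
    + velVar C x • vecMulVec (palmDrift C x) (palmDrift C x)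
    + (s * rayleighMean (velVar C x)) •
        (vecMulVec (palmBump C x) (palmDrift C x) + vecMulVec (palmDrift C x) (palmBump C x))

/-- Rice's up-crossing rate of the level `b = 1` by the stretch `r_x` under the stationary Gaussian
law `C`: `ν⁺ = (2π)⁻¹ √(λ₂/λ₀) e^{-1/(2λ₀)}`. [cite: Aldous1989, §C23 (C23b)] -/
def riceRate (C : Matrix (PhaseIdx n) (PhaseIdx n) ℝ) (x : ZMod n) : ℝ :=
  (2 * Real.pi)⁻¹ * Real.sqrt (velVar C x / stretchVar C x) *
    Real.exp (-(1 / (2 * stretchVar C x)))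

/-- **The Palm-averaged mismatch of second moments at one hit of bond `x`**:
`Δ_x(C) = R_x M⁺ R_xᵀ - M⁻` = E_Palm[(state after the exchange)^{⊗2}] - E_Palm[(state after the free
turnaround)^{⊗2}], the free flow transporting the up-crossing Palm law to the down-crossing one.
[cite: HevelingLast2005, Theorem 1.1] -/
def palmMismatchIncrement (C : Matrix (PhaseIdx n) (PhaseIdx n) ℝ) (x : ZMod n) :
    Matrix (PhaseIdx n) (PhaseIdx n) ℝ :=
  exchangeMatrix x * palmSecondMoment 1 C x * (exchangeMatrix x)ᵀ - palmSecondMoment (-1) C x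

variable (n) in
/-- **The Palm collision field** of the hard-tether ring at temperature `T`: the rate of change of
the second-moment matrix of a (Gaussian, flow-invariant) state `C` produced by the tether hits of
all bonds, both walls `r = ±1` (equal contributions), per unit of the Gibbs two-sided Rice rate:
`𝒩_T(C) = (2ν⁺(G_T))⁻¹ Σ_x 2ν⁺_x(C) Δ_x(C)`. Its derivative at `G_T` is `palmMismatchLin`; the
request's `𝒦` is that derivative, flow-averaged (`trace_mul_palmMismatchLin`). [folklore] -/
def palmCollisionField (ω₂ T : ℝ) (C : Matrix (PhaseIdx n) (PhaseIdx n) ℝ) :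
    Matrix (PhaseIdx n) (PhaseIdx n) ℝ :=
  (2 * riceRate (gibbsCov n ω₂ T) 0)⁻¹ •
    ∑ x : ZMod n, (2 * riceRate C x) • palmMismatchIncrement C x

/-! ### §3. The linearisation at `G_T` -/

/-- The Poisson-exchange increment `R_x δC R_xᵀ - δC` of bond `x` (the action of the exchange
generator `f ↦ f ∘ R_x - f` on second moments).
[cite: BasileBernardinJaraKomorowskiOlla2016, §1 (generator `S`)] -/
def exchangeIncrement (x : ZMod n) (δC : Matrix (PhaseIdx n) (PhaseIdx n) ℝ) :
    Matrix (PhaseIdx n) (PhaseIdx n) ℝ :=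
  exchangeMatrix x * δC * (exchangeMatrix x)ᵀ - δC

/-- The first-order Palm kick mismatch per unit crossing speed,
`m'_x(δC) = D_C[2Cℓ_ṙ*/λ₂ + d_x](G_T)[δC] = T⁻¹ (δC ℓ_ṙ* - ℓ_ṙ* (ℓ_ṙ δC ℓ_ṙ*)/2)`. [folklore] -/
def palmKick (T : ℝ) (x : ZMod n) (δC : Matrix (PhaseIdx n) (PhaseIdx n) ℝ) : PhaseIdx n → ℝ :=
  T⁻¹ • (δC *ᵥ velCovector x - ((velCovector x ⬝ᵥ δC *ᵥ velCovector x) / 2) • velCovector x)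

variable (n) in
/-- The **Palm tilt** of bond `x`: `u_x m'_x(δC)ᵀ + m'_x(δC) u_xᵀ`, the symmetrised product of the
Gibbs position bump with the kick mismatch (to be multiplied by `E V = √(πT)`). [folklore] -/
def palmTilt (ω₂ T : ℝ) (x : ZMod n) (δC : Matrix (PhaseIdx n) (PhaseIdx n) ℝ) :
    Matrix (PhaseIdx n) (PhaseIdx n) ℝ :=
  vecMulVec (palmBump (gibbsCov n ω₂ T) x) (palmKick T x δC)
    + vecMulVec (palmKick T x δC) (palmBump (gibbsCov n ω₂ T) x)

variable (n) in
/-- **The linearised Palm collision field** `Σ_x DΔ_x(G_T)[δC] =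
Σ_x [2 (R_x δC R_xᵀ - δC) + √(πT) (u_x m'_xᵀ + m'_x u_xᵀ)]` (per unit two-sided Rice rate; the
derivative of the Rice weights multiplies `Δ_x(G_T) = 0` and drops out): the finite-ring matrix
version of `𝒦` BEFORE flow-averaging; flow-invariant matrix elements: `trace_mul_palmMismatchLin`.
[folklore] -/
def palmMismatchLin (ω₂ T : ℝ) (δC : Matrix (PhaseIdx n) (PhaseIdx n) ℝ) :
    Matrix (PhaseIdx n) (PhaseIdx n) ℝ :=
  ∑ x : ZMod n, ((2 : ℝ) • exchangeIncrement x δC + rayleighMean (2 * T) • palmTilt n ω₂ T x δC)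

/-! ### §4. Basic API -/

/-- `(a bᵀ) v = (b·v) a`. [folklore] -/
theorem vecMulVec_mulVec_eq_smul {ι : Type*} [Fintype ι] (a b v : ι → ℝ) :
    vecMulVec a b *ᵥ v = (b ⬝ᵥ v) • a := by
  rw [vecMulVec_mulVec, op_smul_eq_smul]

/-- `Φ` is symmetric. [folklore] -/
theorem forceMatrix_transpose (ω₂ : ℝ) : (forceMatrix n ω₂)ᵀ = forceMatrix n ω₂ := by
  unfold forceMatrix bondLaplacian
  simp [transpose_add, transpose_smul, transpose_sum]

/-- `Φ - ω₂ = Σ_x ∇_x ∇_xᵀ` (the identity behind the tilt cancellation). [folklore] -/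
theorem bondLaplacian_eq (ω₂ : ℝ) :
    bondLaplacian n = forceMatrix n ω₂ - ω₂ • (1 : Matrix (ZMod n) (ZMod n) ℝ) := by
  unfold forceMatrix; abel

/-- `Φ` is positive definite for `ω₂ > 0`. [folklore] -/
theorem forceMatrix_posDef {ω₂ : ℝ} (hω : 0 < ω₂) : (forceMatrix n ω₂).PosDef := by
  unfold forceMatrix bondLaplacian
  refine Matrix.PosDef.add_posSemidef (Matrix.PosDef.one.smul hω) ?_
  refine Matrix.posSemidef_sum _ fun x _ => ?_
  simpa using posSemidef_vecMulVec_self_star (R := ℝ) (siteGrad x)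

/-- `Φ Φ⁻¹ = 1` and `Φ⁻¹ Φ = 1` for `ω₂ > 0`. [folklore] -/
theorem forceMatrix_mul_inv {ω₂ : ℝ} (hω : 0 < ω₂) :
    forceMatrix n ω₂ * (forceMatrix n ω₂)⁻¹ = 1 ∧ (forceMatrix n ω₂)⁻¹ * forceMatrix n ω₂ = 1 := by
  have h : IsUnit (forceMatrix n ω₂).det :=
    (Matrix.isUnit_iff_isUnit_det _).mp (forceMatrix_posDef hω).isUnit
  exact ⟨Matrix.mul_nonsing_inv _ h, Matrix.nonsing_inv_mul _ h⟩

/-- `Φ⁻¹` is symmetric. [folklore] -/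
theorem forceMatrix_inv_transpose (ω₂ : ℝ) : ((forceMatrix n ω₂)⁻¹)ᵀ = (forceMatrix n ω₂)⁻¹ := by
  rw [transpose_nonsing_inv, forceMatrix_transpose]

/-- `Aᵀ = [[0, -Φ], [1, 0]]`. [folklore] -/
theorem flowMatrix_transpose (ω₂ : ℝ) :
    (flowMatrix n ω₂)ᵀ = Matrix.fromBlocks 0 (-forceMatrix n ω₂) 1 0 := by
  unfold flowMatrix
  rw [fromBlocks_transpose]
  simp [forceMatrix_transpose]

/-- `G_T` is symmetric. [folklore] -/
theorem gibbsCov_transpose (ω₂ T : ℝ) : (gibbsCov n ω₂ T)ᵀ = gibbsCov n ω₂ T := by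
  unfold gibbsCov
  rw [fromBlocks_transpose]
  simp [forceMatrix_inv_transpose]

/-- **`G_T` is flow-invariant** (`ω₂ > 0`): `A G_T + G_T Aᵀ = 0`. [folklore] -/
theorem isFlowInvariant_gibbsCov {ω₂ : ℝ} (hω : 0 < ω₂) (T : ℝ) :
    IsFlowInvariant (flowMatrix n ω₂) (gibbsCov n ω₂ T) := by
  unfold IsFlowInvariant flowMatrix gibbsCov
  obtain ⟨h1, h2⟩ := forceMatrix_mul_inv (n := n) hω
  rw [fromBlocks_transpose, fromBlocks_multiply, fromBlocks_multiply, fromBlocks_add]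
  simp [forceMatrix_transpose, h1, h2, ← fromBlocks_zero]

/-- `ℓ_ṙ = ℓ_r A` (the stretch velocity is the stretch composed with the flow). [folklore] -/
theorem stretchCovector_vecMul_flowMatrix (ω₂ : ℝ) (x : ZMod n) :
    stretchCovector x ᵥ* flowMatrix n ω₂ = velCovector x := by
  unfold stretchCovector flowMatrix velCovector
  rw [vecMul_fromBlocks]
  ext (i | i) <;> simp

/-- `G_T ℓ_ṙ* = T ℓ_ṙ*` (momenta are white under Gibbs). [folklore] -/
theorem gibbsCov_mulVec_velCovector (ω₂ T : ℝ) (x : ZMod n) :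
    gibbsCov n ω₂ T *ᵥ velCovector x = T • velCovector x := by
  unfold gibbsCov velCovector
  rw [fromBlocks_mulVec]
  ext (i | i) <;> simp [smul_mulVec]

/-- `G_T ℓ_r* = (T Φ⁻¹ ∇_x, 0)`: the Palm bump is a pure position pattern. [folklore] -/
theorem gibbsCov_mulVec_stretchCovector (ω₂ T : ℝ) (x : ZMod n) :
    gibbsCov n ω₂ T *ᵥ stretchCovector x =
      Sum.elim (T • (forceMatrix n ω₂)⁻¹ *ᵥ siteGrad x) 0 := by
  unfold gibbsCov stretchCovector
  rw [fromBlocks_mulVec]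
  ext (i | i) <;> simp [smul_mulVec]

/-- `ℓ_ṙ · (G_T ℓ_r*) = 0` (`Cov(r, ṙ) = 0`), hence `ℓ_ṙ · u = 0` under Gibbs. [folklore] -/
theorem velCovector_dotProduct_palmBump_gibbsCov (ω₂ T : ℝ) (x : ZMod n) :
    velCovector x ⬝ᵥ palmBump (gibbsCov n ω₂ T) x = 0 := by
  unfold palmBump
  rw [dotProduct_smul, gibbsCov_mulVec_stretchCovector]
  unfold velCovector
  rw [sumElim_dotProduct_sumElim]
  simp

/-- `ℓ_ṙ · σ = p_{x+1} - p_x`. [folklore] -/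
theorem velCovector_dotProduct (x : ZMod n) (v : PhaseIdx n → ℝ) :
    velCovector x ⬝ᵥ v = v (Sum.inr (x + 1)) - v (Sum.inr x) := by
  unfold velCovector siteGrad
  rw [← Sum.elim_comp_inl_inr v, sumElim_dotProduct_sumElim, zero_dotProduct, zero_add,
    sub_dotProduct, single_dotProduct, single_dotProduct]
  simp

/-- `ℓ_r · σ = q_{x+1} - q_x`. [folklore] -/
theorem stretchCovector_dotProduct (x : ZMod n) (v : PhaseIdx n → ℝ) :
    stretchCovector x ⬝ᵥ v = v (Sum.inl (x + 1)) - v (Sum.inl x) := by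
  unfold stretchCovector siteGrad
  rw [← Sum.elim_comp_inl_inr v, sumElim_dotProduct_sumElim, zero_dotProduct, add_zero,
    sub_dotProduct, single_dotProduct, single_dotProduct]
  simp

/-- The exchange acts by `R_x v = v - (ℓ_ṙ · v) ℓ_ṙ*`. [folklore] -/
theorem exchangeMatrix_mulVec (x : ZMod n) (v : PhaseIdx n → ℝ) :
    exchangeMatrix x *ᵥ v = v - (velCovector x ⬝ᵥ v) • velCovector x := by
  unfold exchangeMatrix
  rw [sub_mulVec, one_mulVec, vecMulVec_mulVec_eq_smul]

/-- `R_x` fixes positions. [folklore] -/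
theorem exchangeMatrix_mulVec_inl (x : ZMod n) (v : PhaseIdx n → ℝ) (y : ZMod n) :
    (exchangeMatrix x *ᵥ v) (Sum.inl y) = v (Sum.inl y) := by
  rw [exchangeMatrix_mulVec]
  simp [velCovector]

section Nontrivial

variable [Fact (1 < n)]

omit [NeZero n] in
/-- On a ring with `n ≥ 2` sites the two ends of a bond differ. [folklore] -/
theorem succ_ne_self (x : ZMod n) : x + 1 ≠ x :=
  fun h => one_ne_zero (add_left_cancel (a := x) (by rw [add_zero]; exact h))

/-- `∇_x · ∇_x = 2`. [folklore] -/
theorem siteGrad_dotProduct_self (x : ZMod n) : siteGrad x ⬝ᵥ siteGrad x = 2 := by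
  unfold siteGrad
  have h := succ_ne_self x
  rw [sub_dotProduct, dotProduct_sub, dotProduct_sub, single_dotProduct, single_dotProduct,
    single_dotProduct, single_dotProduct]
  simp [h, h.symm]
  norm_num

/-- `ℓ_ṙ · ℓ_ṙ = 2`. [folklore] -/
theorem velCovector_dotProduct_self (x : ZMod n) : velCovector x ⬝ᵥ velCovector x = 2 := by
  unfold velCovector
  rw [sumElim_dotProduct_sumElim, siteGrad_dotProduct_self]
  simp

/-- `λ₂(G_T) = 2T`. [folklore] -/
theorem velVar_gibbsCov (ω₂ T : ℝ) (x : ZMod n) : velVar (gibbsCov n ω₂ T) x = 2 * T := by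
  unfold velVar
  rw [gibbsCov_mulVec_velCovector, dotProduct_smul, velCovector_dotProduct_self]
  simp [mul_comm]

/-- **Under Gibbs `w = ℓ_ṙ*/2 = -d_x/2`** (the zeroth-order cancellation). [folklore] -/
theorem palmDrift_gibbsCov (ω₂ : ℝ) {T : ℝ} (hT : T ≠ 0) (x : ZMod n) :
    palmDrift (gibbsCov n ω₂ T) x = (1 / 2 : ℝ) • velCovector x := by
  unfold palmDrift
  rw [velVar_gibbsCov, gibbsCov_mulVec_velCovector, smul_smul]
  congr 1
  field_simp

end Nontrivial

end Literature.MathematicalPhysics.KineticTheory.PalmMismatch
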